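import Summits.CriticalPhenomena.CardyFormulaZ2.Theorems.CardySelfDualSegmentUniformMarginalityCrudeContinuityFor
import Summits.CriticalPhenomena.CardyFormulaZ2.Theorems.CardySelfDualSegmentUniformMarginalityReduction
import Summits.CriticalPhenomena.CardyFormulaZ2.Theorems.CardySelfDualSegmentUniformMarginalityBasePointTransportParam
import Summits.CriticalPhenomena.CardyFormulaZ2.Theorems.CardySelfDualSegmentUniformMarginalityFixedDomainContinuityZero
import Literature.Probability.Percolation.QuadCrossingContinuityEventsDischarge

/-!
# Fixed-parameter domain continuity at the bond-ℤ² endpoint `t₀ = 1` (stub (N) of skeleton v9/v10, line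
`Sketch`, crux `UniformMarginality`, stmt-CriticalPhenomena-5472)

THE STATEMENT (`fixedDomainContinuity_one`, strong form; `stub_fixedDomainContinuity_one`, registered form).  For every
conformal rectangle `R` — arbitrary (wild) Jordan boundary — and `ε > 0` there are `ε₀ > 0` and ONE mesh threshold
`δ₀ > 0` such that every conformal rectangle `Q` whose boundary loop is pointwise `ε₀`-close to that of `R` and whose
mark parameters are `ε₀`-close satisfies `|P_1(Q,δ) − P_1(R,δ)| ≤ ε` for all `0 < δ < δ₀`, where
`P_1(·,δ) = Pext · δ 1` is the crude `M_1`-crossing probability (`crossEvent`, `embDomainCrossing` on `√2 ℤ²`) and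
`M_1 = P_{1/2}` bond percolation on `ℤ²` (`cornerPercolation_one`).  No tameness of `Q` or `R` is assumed.

THE PROOF.  Schramm–Smirnov 2011 Lemma 5.1 is discharged in the tree for critical bond-ℤ²
(`QuadCrossing.SchrammSmirnov2011_lemma_5_1_holds`), hence the discrete estimate (5.1) at every quad of the plane
(`Quad.continuity_of_lemma_5_1`) — this is the `t₀ = 1` instance of the open-interval kernel (B₂ᵒ) of skeleton v10
(`discreteContinuity_one`).  The general-law bridge `fixedDomainContinuityAt_of_discrete`
(`…CrudeContinuityFor.lean`: the CardyIKTransport Freeze bridge and the endpoint assembly, re-run for an arbitrary law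
carried by lattice configurations, over the transferred sandwiches N1–N3) does the rest.

ALSO HERE: the case glue `fixedDomainContinuity_of_cases` of the skeleton (landed form); the `t₀ = 1` twin
`integratedBoundAtOne_of_rectilinear` of the base-point transport (UM at `t₀ = 1` for EVERY conformal rectangle from
(B₁) at `t₀ = 1` on rectilinear ones, unconditionally); and the v10 reduction
`uniformMarginality_of_rectilinear_of_discreteInterior` : (B₁) → (B₂ᵒ) → `UniformMarginality`.
-/

noncomputable section

namespace Summit.CriticalPhenomena.CardyFormulaZ2.Cruxes.UniformMarginality.HeatFlow

open scoped ENNReal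
open Set Metric Filter MeasureTheory
open Literature.Probability.Percolation Literature.Probability.LatticeModels
  Literature.Probability.RandomPlanarGeometry
open Literature.Probability.Percolation.QuadCrossing (Quad)
open Literature.Probability.Percolation.QuadCrossing.Quad (StrictlyDominated)

/-! ## `t₀ = 1`: Schramm–Smirnov (5.1) for `M_1 = P_{1/2}` bond-ℤ² -/

/-- **(B₂ᵒ) holds at the endpoint `t₀ = 1`**: Schramm–Smirnov's discrete estimate (5.1) for `M_1` at every quad of
the plane — the tree's `Quad.continuity_of_lemma_5_1 SchrammSmirnov2011_lemma_5_1_holds` read through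
`cornerPercolation_one`. -/
theorem discreteContinuity_one :
    ∀ (Q₀ : Quad (univ : Set ℂ)) (ε : ℝ≥0∞), 0 < ε →
      ∃ Q' Q'' : Quad (univ : Set ℂ), StrictlyDominated Q' Q₀ ∧ StrictlyDominated Q₀ Q'' ∧
        ∃ δ₀ : ℝ, 0 < δ₀ ∧ ∀ δ : ℝ, 0 < δ → δ < δ₀ →
          cornerPercolation 1 {ω | (∃ K, Q'.IsCrossing K ∧ K ⊆ openEdgeUnion δ ω) ∧
              ¬ ∃ K, Q''.IsCrossing K ∧ K ⊆ openEdgeUnion δ ω} ≤ ε := by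
  rw [cornerPercolation_one]
  exact fun Q₀ ε hε =>
    QuadCrossing.Quad.continuity_of_lemma_5_1 QuadCrossing.SchrammSmirnov2011_lemma_5_1_holds Q₀ ε hε

/-- **Fixed-parameter domain continuity at `t₀ = 1`, in the shape of the kernel (B₂a″)** (rectilinearity of `Q`
unused): the general-law bridge at `t₀ = 1` fed with `discreteContinuity_one`. -/
theorem fixedDomainContinuity_one :
    ∀ (R : ConformalRectangle) (ε : ℝ), 0 < ε → ∃ ε₀ > 0, ∀ Q : ConformalRectangle,
      (∃ S : Finset (ℂ × ℂ), (∀ p ∈ S, p.1.re = p.2.re ∨ p.1.im = p.2.im) ∧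
        frontier Q.carrier ⊆ ⋃ p ∈ S, segment ℝ p.1 p.2) →
      (∀ u : ℝ, dist (Q.boundary u) (R.boundary u) ≤ ε₀) → (∀ i : Fin 4, |Q.mark i - R.mark i| ≤ ε₀) →
      ∃ δ₀ > 0, ∀ δ : ℝ, 0 < δ → δ < δ₀ → |Pext Q δ 1 - Pext R δ 1| ≤ ε :=
  fixedDomainContinuityAt_of_discrete 1 discreteContinuity_one

/-- **The registered stub (N) of skeleton v9**: the fixed-parameter kernel (B₂a″) at `t₀ = 1` in exactly the shape
consumed by the case glue `fixedDomainContinuity_of_cases`. -/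
theorem stub_fixedDomainContinuity_one :
    ∀ (R : ConformalRectangle) (ε : ℝ), 0 < ε → ∃ ε₀ > 0, ∀ Q : ConformalRectangle,
      (∃ S : Finset (ℂ × ℂ), (∀ p ∈ S, p.1.re = p.2.re ∨ p.1.im = p.2.im) ∧
        frontier Q.carrier ⊆ ⋃ p ∈ S, segment ℝ p.1 p.2) →
      (∀ u : ℝ, dist (Q.boundary u) (R.boundary u) ≤ ε₀) → (∀ i : Fin 4, |Q.mark i - R.mark i| ≤ ε₀) →
      ∃ δ₀ > 0, ∀ δ : ℝ, 0 < δ → δ < δ₀ → |Pext Q δ 1 - Pext R δ 1| ≤ ε :=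
  fixedDomainContinuity_one

/-- **Strong form** (one `ε₀`, ONE mesh threshold for all `ε₀`-close `Q`, no tameness): directly from the
general-law Step 2 at `μ = P_{1/2}`. -/
theorem fixedDomainContinuity_one_uniform :
    ∀ (R : ConformalRectangle) (ε : ℝ), 0 < ε → ∃ ε₀ > 0, ∃ δ₀ > 0, ∀ Q : ConformalRectangle,
      (∀ u : ℝ, dist (Q.boundary u) (R.boundary u) ≤ ε₀) → (∀ i : Fin 4, |Q.mark i - R.mark i| ≤ ε₀) →
      ∀ δ : ℝ, 0 < δ → δ < δ₀ → |Pext Q δ 1 - Pext R δ 1| ≤ ε := by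
  intro R ε hε
  have hM : M 1 = cornerPercolation 1 := by
    unfold M
    rw [show Set.projIcc (0:ℝ) 1 zero_le_one 1 = 1 from Set.projIcc_right _]
  obtain ⟨ε₀, hε₀, δ₀, hδ₀, h⟩ := fixedDomainContinuityFor_of_crudeContinuity (cornerPercolation 1)
    (cornerPercolation_subset_edgeSet _)
    (crudeContinuityFor_of_discrete (cornerPercolation 1) (cornerPercolation_subset_edgeSet _)
      discreteContinuity_one) R ε hε
  refine ⟨ε₀, hε₀, δ₀, hδ₀, fun Q hb hm δ hδ hδlt => ?_⟩
  rw [Pext_eq_M, Pext_eq_M, hM]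
  exact h Q hb hm δ hδ hδlt

/-! ## The case glue of the skeleton, landed -/

/-- GLUE: **the fixed-parameter kernel on `[0,1]` by cases** — the `t₀ = 0` kernel (landed
`fixedDomainContinuity_zero`), a `t₀ = 1` kernel and an open-interval kernel give the v6 kernel (B₂a″) at every
`t₀ ∈ [0,1]`, in exactly the shape consumed by `stub_uniformSandwichOfFixedDomainContinuity`. -/
theorem fixedDomainContinuity_of_cases
    (h0 : ∀ (R : ConformalRectangle) (ε : ℝ), 0 < ε → ∃ ε₀ > 0, ∀ Q : ConformalRectangle,
      (∃ S : Finset (ℂ × ℂ), (∀ p ∈ S, p.1.re = p.2.re ∨ p.1.im = p.2.im) ∧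
        frontier Q.carrier ⊆ ⋃ p ∈ S, segment ℝ p.1 p.2) →
      (∀ u : ℝ, dist (Q.boundary u) (R.boundary u) ≤ ε₀) → (∀ i : Fin 4, |Q.mark i - R.mark i| ≤ ε₀) →
      ∃ δ₀ > 0, ∀ δ : ℝ, 0 < δ → δ < δ₀ → |Pext Q δ 0 - Pext R δ 0| ≤ ε)
    (h1 : ∀ (R : ConformalRectangle) (ε : ℝ), 0 < ε → ∃ ε₀ > 0, ∀ Q : ConformalRectangle,
      (∃ S : Finset (ℂ × ℂ), (∀ p ∈ S, p.1.re = p.2.re ∨ p.1.im = p.2.im) ∧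
        frontier Q.carrier ⊆ ⋃ p ∈ S, segment ℝ p.1 p.2) →
      (∀ u : ℝ, dist (Q.boundary u) (R.boundary u) ≤ ε₀) → (∀ i : Fin 4, |Q.mark i - R.mark i| ≤ ε₀) →
      ∃ δ₀ > 0, ∀ δ : ℝ, 0 < δ → δ < δ₀ → |Pext Q δ 1 - Pext R δ 1| ≤ ε)
    (hint : ∀ (R : ConformalRectangle) (t₀ : ℝ), t₀ ∈ Set.Ioo (0 : ℝ) 1 → ∀ ε : ℝ, 0 < ε →
      ∃ ε₀ > 0, ∀ Q : ConformalRectangle,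
        (∃ S : Finset (ℂ × ℂ), (∀ p ∈ S, p.1.re = p.2.re ∨ p.1.im = p.2.im) ∧
          frontier Q.carrier ⊆ ⋃ p ∈ S, segment ℝ p.1 p.2) →
        (∀ u : ℝ, dist (Q.boundary u) (R.boundary u) ≤ ε₀) → (∀ i : Fin 4, |Q.mark i - R.mark i| ≤ ε₀) →
        ∃ δ₀ > 0, ∀ δ : ℝ, 0 < δ → δ < δ₀ → |Pext Q δ t₀ - Pext R δ t₀| ≤ ε) :
    ∀ (R : ConformalRectangle) (t₀ : ℝ), t₀ ∈ Set.Icc (0 : ℝ) 1 → ∀ ε : ℝ, 0 < ε →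
      ∃ ε₀ > 0, ∀ Q : ConformalRectangle,
        (∃ S : Finset (ℂ × ℂ), (∀ p ∈ S, p.1.re = p.2.re ∨ p.1.im = p.2.im) ∧
          frontier Q.carrier ⊆ ⋃ p ∈ S, segment ℝ p.1 p.2) →
        (∀ u : ℝ, dist (Q.boundary u) (R.boundary u) ≤ ε₀) → (∀ i : Fin 4, |Q.mark i - R.mark i| ≤ ε₀) →
        ∃ δ₀ > 0, ∀ δ : ℝ, 0 < δ → δ < δ₀ → |Pext Q δ t₀ - Pext R δ t₀| ≤ ε := by
  intro R t₀ ht₀ ε hε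
  rcases eq_or_lt_of_le ht₀.1 with h | h
  · subst h
    exact h0 R ε hε
  rcases eq_or_lt_of_le ht₀.2 with h' | h'
  · subst h'
    exact h1 R ε hε
  · exact hint R t₀ ⟨h, h'⟩ ε hε

/-! ## Consequences: the `t₀ = 1` base-point transport; the v10 reduction of the crux -/

/-- `Pext R δ 1` is the route's `P 1 R δ`. -/
theorem Pext_one (R : ConformalRectangle) (δ : ℝ) : Pext R δ 1 = cornerCrossingProb 1 R δ := by
  rw [← Pext_coe R δ 1]
  rfl

/-- **At the bond-ℤ² endpoint the crux reduces to tame domains, unconditionally**: if for every RECTILINEAR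
conformal rectangle the map `t ↦ P_t(·,δ)` is continuous at `t = 1` uniformly in the mesh, then the same holds for
EVERY conformal rectangle — the `t₀ = 1` twin of `integratedBoundAtZero_of_rectilinear` (p116976), by the
parameter-localised transport `integratedBoundAtParam_of_fixedDomainContinuity` (p116916). -/
theorem integratedBoundAtOne_of_rectilinear :
    (∀ R : ConformalRectangle,
      (∃ S : Finset (ℂ × ℂ), (∀ p ∈ S, p.1.re = p.2.re ∨ p.1.im = p.2.im) ∧
        frontier R.carrier ⊆ ⋃ p ∈ S, segment ℝ p.1 p.2) →
      ∀ ε > 0, ∃ η > 0, ∀ δ : ℝ, 0 < δ → ∀ t ∈ Set.Icc (0 : ℝ) 1, |t - 1| < η →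
        |Pext R δ t - Pext R δ 1| < ε) →
    ∀ R : ConformalRectangle, ∀ ε > 0, ∃ η > 0, ∀ δ : ℝ, 0 < δ → ∀ t ∈ Set.Icc (0 : ℝ) 1,
      |t - 1| < η → |Pext R δ t - Pext R δ 1| < ε :=
  fun hB => integratedBoundAtParam_of_fixedDomainContinuity 1 ⟨zero_le_one, le_rfl⟩ fixedDomainContinuity_one hB

/-- **The crux reduced to its two research kernels (skeleton v10, as a theorem in the tree)**: (B₁) the crux on
rectilinear conformal rectangles and (B₂ᵒ) Schramm–Smirnov's discrete estimate (5.1) for the single corner model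
`M_{t₀}`, `0 < t₀ < 1`, at every quad of the plane, imply `CardySelfDualSegment.UniformMarginality` for every
conformal rectangle.  Everything else is landed: the general-law bridge (`fixedDomainContinuityAt_of_discrete`), the
two endpoint kernels (`fixedDomainContinuity_zero`, `fixedDomainContinuity_one`), the case glue, the v6 glue
`stub_uniformSandwichOfFixedDomainContinuity` (p116281), the transport `stub_transportOfUniformSandwich` (p111792)
and `uniformMarginality_of_integratedBound` (p96304). -/
theorem uniformMarginality_of_rectilinear_of_discreteInterior
    (hB₁ : ∀ R : ConformalRectangle,
      (∃ S : Finset (ℂ × ℂ), (∀ p ∈ S, p.1.re = p.2.re ∨ p.1.im = p.2.im) ∧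
        frontier R.carrier ⊆ ⋃ p ∈ S, segment ℝ p.1 p.2) →
      ∀ t₀ : ℝ, t₀ ∈ Set.Icc (0 : ℝ) 1 → ∀ ε > 0, ∃ η > 0,
        ∀ δ : ℝ, 0 < δ → ∀ t ∈ Set.Icc (0 : ℝ) 1, |t - t₀| < η → |Pext R δ t - Pext R δ t₀| < ε)
    (hB₂ : ∀ t₀ : unitInterval, 0 < (t₀ : ℝ) → (t₀ : ℝ) < 1 →
      ∀ (Q₀ : Quad (univ : Set ℂ)) (ε : ℝ≥0∞), 0 < ε →
        ∃ Q' Q'' : Quad (univ : Set ℂ), StrictlyDominated Q' Q₀ ∧ StrictlyDominated Q₀ Q'' ∧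
          ∃ δ₀ : ℝ, 0 < δ₀ ∧ ∀ δ : ℝ, 0 < δ → δ < δ₀ →
            cornerPercolation t₀ {ω | (∃ K, Q'.IsCrossing K ∧ K ⊆ openEdgeUnion δ ω) ∧
                ¬ ∃ K, Q''.IsCrossing K ∧ K ⊆ openEdgeUnion δ ω} ≤ ε) :
    Summit.CriticalPhenomena.CardyFormulaZ2.Theses.CardySelfDualSegment.UniformMarginality :=
  uniformMarginality_of_integratedBound
    (stub_transportOfUniformSandwich
      (stub_uniformSandwichOfFixedDomainContinuity
        (fixedDomainContinuity_of_cases fixedDomainContinuity_zero fixedDomainContinuity_one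
          (fun R t₀ ht₀ ε hε => fixedDomainContinuityAt_of_discrete ⟨t₀, ⟨ht₀.1.le, ht₀.2.le⟩⟩
            (hB₂ ⟨t₀, ⟨ht₀.1.le, ht₀.2.le⟩⟩ ht₀.1 ht₀.2) R ε hε))
        hB₁)
      hB₁)

end Summit.CriticalPhenomena.CardyFormulaZ2.Cruxes.UniformMarginality.HeatFlow

end
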